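import Summits.QuantumFields.YangMills.Theorems.F4SubCurvatureDoorShellSeparationWeightedLines
import Summits.QuantumFields.YangMills.Theorems.F4SubCurvatureDoorRationalToGeneralOneSidedDeterminacy
import Summits.QuantumFields.YangMills.Theorems.F4SubCurvatureDoorFibreDichotomyShellLFAnalytic
import Summits.QuantumFields.YangMills.Theorems.F4SubCurvatureDoorFibreReductionDisintegration
import Mathlib
import HarnessLib

/-!
# LINE g21-A/g21-B (⟨stmt-QuantumFields-23125⟩) — S2 helper: a signed density with vanishing shifted-mass moments has vanishing mass-window
# integrals (the determinacy step of shell separation)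

Helper toward the registered stub S2 `stub_shellSeparation`.  Let `μ` be carried by `E ≥ 0`, Laplace-integrable, with `‖q⃗‖ ≤ E + A` and
`E² − ‖q⃗‖² ≥ −Q₀` a.e. (no deep space-like mass).  If a continuous density `f` with `|f| ≤ 2e^{−tE}` a.e. (`t > 0`) has
`∫ (E² − ‖q⃗‖² + Q₀)^k f dμ = 0` for every `k`, then `∫_{massSq ∈ S} f dμ = 0` for every measurable window `S` (`setIntegral_eq_zero_of_moments`).

Proof: the push-forwards `σ, τ` of `f⁺μ, f⁻μ` along `λ = massSq + Q₀ ≥ 0` are finite, carried by `[0, ∞)`, have equal power moments and an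
exponential square-root moment (`√λ ≤ E + √|Q₀|`, `c = t/2`); by the landed rung R-S2c ✓`oneSidedDeterminacy_holds` they coincide, and the
window integrals of `f = f⁺ − f⁻` vanish.  This is step (4) of the shell-separation mechanism (Stieltjes determinacy).

Mathlib + tree only; no `sorry`; no new definitions.  HONEST LABEL: helper for a registered stub of an OPEN line; S1, S2, ⟨23125⟩, ⟨23035⟩, R2d
and the Yang–Mills mass gap remain OPEN; no summit is proved by a line.
-/

noncomputable section

open MeasureTheory Set Filter Topology
open scoped BigOperators ENNReal

namespace Summit.QuantumFields.YangMills.Theorems.F4SubCurvatureDoorShellSeparationProof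

open Summit.QuantumFields.YangMills.Theorems.F4SubCurvatureDoorLaplaceFourierRegistered (E4 E3)
open Summit.QuantumFields.YangMills.Theorems.F4SubCurvatureDoorShellLFAnalytic (massSq)
open Summit.QuantumFields.YangMills.Theorems.F4SubCurvatureDoorSmearedSlices (ae_nonneg_of_measure_Iio)
open Summit.QuantumFields.YangMills.Theorems.F4SubCurvatureDoorOneSidedDeterminacyRegistered (oneSidedDeterminacy_holds)
open Summit.QuantumFields.YangMills.Theorems.F4SubCurvatureDoorFibreReduction (measurable_massSq)

variable {μ : Measure (ℝ × E3)}

/-- **The square root of the shifted mass is dominated by the energy**: `√(massSq + Q₀) ≤ E + √|Q₀|` when `E ≥ 0`. -/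
theorem sqrt_shiftedMass_le {p : ℝ × E3} (hE : 0 ≤ p.1) (Q₀ : ℝ) : Real.sqrt (massSq p + Q₀) ≤ p.1 + Real.sqrt |Q₀| := by
  have h1 : massSq p + Q₀ ≤ (p.1 + Real.sqrt |Q₀|) ^ 2 := by
    have hs : (Real.sqrt |Q₀|) ^ 2 = |Q₀| := Real.sq_sqrt (abs_nonneg _)
    have hQ : Q₀ ≤ |Q₀| := le_abs_self _
    rw [massSq]
    nlinarith [sq_nonneg ‖p.2‖, Real.sqrt_nonneg |Q₀|, mul_nonneg hE (Real.sqrt_nonneg |Q₀|)]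
  calc Real.sqrt (massSq p + Q₀) ≤ Real.sqrt ((p.1 + Real.sqrt |Q₀|) ^ 2) := Real.sqrt_le_sqrt h1
    _ = p.1 + Real.sqrt |Q₀| := Real.sqrt_sq (by positivity)

/-- **Vanishing shifted-mass moments force vanishing mass-window integrals** (Stieltjes determinacy, via R-S2c). -/
theorem setIntegral_eq_zero_of_moments (h0 : μ (Set.Iio (0 : ℝ) ×ˢ (Set.univ : Set E3)) = 0)
    (hint : ∀ t : ℝ, 0 < t → Integrable (fun p : ℝ × E3 => Real.exp (-(t * p.1))) μ)
    (Q₀ : ℝ) (hQ : ∀ᵐ p ∂μ, -Q₀ ≤ massSq p)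
    {f : ℝ × E3 → ℝ} (hfc : Continuous f) {t : ℝ} (ht : 0 < t) (hfb : ∀ᵐ p ∂μ, |f p| ≤ 2 * Real.exp (-(t * p.1)))
    (hmomint : ∀ k : ℕ, Integrable (fun p : ℝ × E3 => (massSq p + Q₀) ^ k * f p) μ)
    (hmom : ∀ k : ℕ, ∫ p, (massSq p + Q₀) ^ k * f p ∂μ = 0) {S : Set ℝ} (hS : MeasurableSet S) :
    ∫ p in massSq ⁻¹' S, f p ∂μ = 0 := by
  have hE := ae_nonneg_of_measure_Iio μ h0
  have hfm : Measurable f := hfc.measurable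
  -- the two densities `f⁺, f⁻` (as `ℝ≥0∞`-valued functions) and the shifted mass
  set ρp : ℝ × E3 → ℝ≥0∞ := fun p => ENNReal.ofReal (f p) with hρp
  set ρm : ℝ × E3 → ℝ≥0∞ := fun p => ENNReal.ofReal (-f p) with hρm
  have hρpm : Measurable ρp := hfm.ennreal_ofReal
  have hρmm : Measurable ρm := hfm.neg.ennreal_ofReal
  set φ : ℝ × E3 → ℝ := fun p => massSq p + Q₀ with hφ
  have hφm : Measurable φ := measurable_massSq.add_const _
  -- integrability of `|f|`
  have hfi : Integrable f μ := ((hint t ht).const_mul 2).mono' hfc.aestronglyMeasurable (by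
    filter_upwards [hfb] with p hp; rwa [Real.norm_eq_abs])
  have hρp_fin : ∫⁻ p, ρp p ∂μ < ∞ := by
    refine lt_of_le_of_lt (lintegral_mono fun p => ?_) hfi.2
    exact ENNReal.ofReal_le_ofReal (le_abs_self _) |>.trans (by rw [Real.enorm_eq_ofReal_abs])
  have hρm_fin : ∫⁻ p, ρm p ∂μ < ∞ := by
    refine lt_of_le_of_lt (lintegral_mono fun p => ?_) hfi.2
    exact ENNReal.ofReal_le_ofReal (neg_le_abs _) |>.trans (by rw [Real.enorm_eq_ofReal_abs])
  -- the push-forwards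
  set σ : Measure ℝ := (μ.withDensity ρp).map φ with hσ
  set τ : Measure ℝ := (μ.withDensity ρm).map φ with hτ
  haveI hμp : IsFiniteMeasure (μ.withDensity ρp) := ⟨by rw [withDensity_apply _ MeasurableSet.univ, Measure.restrict_univ]; exact hρp_fin⟩
  haveI hμm : IsFiniteMeasure (μ.withDensity ρm) := ⟨by rw [withDensity_apply _ MeasurableSet.univ, Measure.restrict_univ]; exact hρm_fin⟩
  haveI : IsFiniteMeasure σ := Measure.isFiniteMeasure_map _ _
  haveI : IsFiniteMeasure τ := Measure.isFiniteMeasure_map _ _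
  -- support in `[0, ∞)`
  have hneg0 : μ (φ ⁻¹' Set.Iio 0) = 0 := by
    rw [measure_eq_zero_iff_ae_notMem]
    filter_upwards [hQ] with p hp
    simp only [mem_preimage, mem_Iio, not_lt, hφ]
    linarith
  have hσ0 : σ (Set.Iio 0) = 0 := by
    rw [hσ, Measure.map_apply hφm measurableSet_Iio]
    exact withDensity_absolutelyContinuous μ ρp hneg0
  have hτ0 : τ (Set.Iio 0) = 0 := by
    rw [hτ, Measure.map_apply hφm measurableSet_Iio]
    exact withDensity_absolutelyContinuous μ ρm hneg0
  -- integrals against `σ`, `τ` in terms of `μ`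
  have hρp_lt : ∀ᵐ p ∂μ, ρp p < ∞ := Eventually.of_forall fun p => ENNReal.ofReal_lt_top
  have hρm_lt : ∀ᵐ p ∂μ, ρm p < ∞ := Eventually.of_forall fun p => ENNReal.ofReal_lt_top
  have hintσ : ∀ g : ℝ → ℝ, Continuous g → ∫ x, g x ∂σ = ∫ p, max (f p) 0 * g (φ p) ∂μ := by
    intro g hg
    rw [hσ, integral_map hφm.aemeasurable hg.aestronglyMeasurable, integral_withDensity_eq_integral_toReal_smul hρpm hρp_lt]
    refine integral_congr_ae (ae_of_all _ fun p => ?_)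
    simp only [hρp, ENNReal.toReal_ofReal', smul_eq_mul]
  have hintτ : ∀ g : ℝ → ℝ, Continuous g → ∫ x, g x ∂τ = ∫ p, max (-f p) 0 * g (φ p) ∂μ := by
    intro g hg
    rw [hτ, integral_map hφm.aemeasurable hg.aestronglyMeasurable, integral_withDensity_eq_integral_toReal_smul hρmm hρm_lt]
    refine integral_congr_ae (ae_of_all _ fun p => ?_)
    simp only [hρm, ENNReal.toReal_ofReal', smul_eq_mul]
  have hintegσ : ∀ g : ℝ → ℝ, Continuous g → (Integrable g σ ↔ Integrable (fun p => max (f p) 0 * g (φ p)) μ) := by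
    intro g hg
    rw [hσ, integrable_map_measure hg.aestronglyMeasurable hφm.aemeasurable, integrable_withDensity_iff_integrable_smul' hρpm hρp_lt]
    simp only [hρp, ENNReal.toReal_ofReal', smul_eq_mul, Function.comp_def]
  have hintegτ : ∀ g : ℝ → ℝ, Continuous g → (Integrable g τ ↔ Integrable (fun p => max (-f p) 0 * g (φ p)) μ) := by
    intro g hg
    rw [hτ, integrable_map_measure hg.aestronglyMeasurable hφm.aemeasurable, integrable_withDensity_iff_integrable_smul' hρmm hρm_lt]
    simp only [hρm, ENNReal.toReal_ofReal', smul_eq_mul, Function.comp_def]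
  -- bounds `max (±f) 0 ≤ |f|`
  have hmaxp : ∀ p, |max (f p) 0| ≤ |f p| := fun p => by
    rw [abs_of_nonneg (le_max_right _ _)]; exact max_le (le_abs_self _) (abs_nonneg _)
  have hmaxm : ∀ p, |max (-f p) 0| ≤ |f p| := fun p => by
    rw [abs_of_nonneg (le_max_right _ _)]; exact max_le (neg_le_abs _) (abs_nonneg _)
  -- exponential square-root moments with `c = t/2`
  set c : ℝ := t / 2 with hc
  have hcpos : 0 < c := by positivity
  have hexpc : Continuous fun x : ℝ => Real.exp (c * Real.sqrt x) := by fun_prop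
  have hexp_int : ∀ (s : ℝ × E3 → ℝ), (∀ p, |s p| ≤ |f p|) → Measurable s →
      Integrable (fun p => s p * Real.exp (c * Real.sqrt (φ p))) μ := by
    intro s hs hsm
    refine ((hint c hcpos).const_mul (2 * Real.exp (c * Real.sqrt |Q₀|))).mono'
      ((hsm.mul (hexpc.measurable.comp hφm)).aestronglyMeasurable) ?_
    filter_upwards [hfb, hE] with p hp hEp
    rw [Real.norm_eq_abs, abs_mul, abs_of_pos (Real.exp_pos _)]
    have h1 : Real.exp (c * Real.sqrt (φ p)) ≤ Real.exp (c * Real.sqrt |Q₀|) * Real.exp (c * p.1) := by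
      rw [← Real.exp_add]
      exact Real.exp_le_exp.2 (by nlinarith [sqrt_shiftedMass_le hEp Q₀, Real.sqrt_nonneg (φ p)])
    have h2 : |s p| ≤ 2 * Real.exp (-(t * p.1)) := (hs p).trans hp
    calc |s p| * Real.exp (c * Real.sqrt (φ p)) ≤ 2 * Real.exp (-(t * p.1)) * (Real.exp (c * Real.sqrt |Q₀|) * Real.exp (c * p.1)) :=
          mul_le_mul h2 h1 (Real.exp_pos _).le (by positivity)
      _ = 2 * Real.exp (c * Real.sqrt |Q₀|) * Real.exp (-(c * p.1)) := by
          rw [hc]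
          have : Real.exp (-(t * p.1)) * Real.exp (t / 2 * p.1) = Real.exp (-(t / 2 * p.1)) := by
            rw [← Real.exp_add]; ring_nf
          calc 2 * Real.exp (-(t * p.1)) * (Real.exp (t / 2 * Real.sqrt |Q₀|) * Real.exp (t / 2 * p.1))
              = 2 * Real.exp (t / 2 * Real.sqrt |Q₀|) * (Real.exp (-(t * p.1)) * Real.exp (t / 2 * p.1)) := by ring
            _ = _ := by rw [this]
  have hσi : Integrable (fun q : ℝ => Real.exp (c * Real.sqrt q)) σ :=
    (hintegσ _ hexpc).2 (hexp_int _ hmaxp (hfm.max measurable_const))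
  have hτi : Integrable (fun q : ℝ => Real.exp (c * Real.sqrt q)) τ :=
    (hintegτ _ hexpc).2 (hexp_int _ hmaxm (hfm.neg.max measurable_const))
  -- equal moments
  have hmomeq : ∀ k : ℕ, ∫ q, q ^ k ∂σ = ∫ q, q ^ k ∂τ := by
    intro k
    rw [hintσ _ (continuous_pow k), hintτ _ (continuous_pow k)]
    have hip : Integrable (fun p => max (f p) 0 * φ p ^ k) μ := by
      refine (hmomint k).abs.mono' ((hfm.max measurable_const).mul (hφm.pow_const k)).aestronglyMeasurable
        (Eventually.of_forall fun p => ?_)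
      rw [Real.norm_eq_abs, abs_mul, abs_mul, mul_comm]
      exact mul_le_mul_of_nonneg_left (hmaxp p) (abs_nonneg _)
    have him : Integrable (fun p => max (-f p) 0 * φ p ^ k) μ := by
      refine (hmomint k).abs.mono' ((hfm.neg.max measurable_const).mul (hφm.pow_const k)).aestronglyMeasurable
        (Eventually.of_forall fun p => ?_)
      rw [Real.norm_eq_abs, abs_mul, abs_mul, mul_comm]
      exact mul_le_mul_of_nonneg_left (hmaxm p) (abs_nonneg _)
    have hdiff : (∫ p, max (f p) 0 * φ p ^ k ∂μ) - ∫ p, max (-f p) 0 * φ p ^ k ∂μ = 0 := by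
      rw [← integral_sub hip him]
      have e : (fun p => max (f p) 0 * φ p ^ k - max (-f p) 0 * φ p ^ k) = fun p => (massSq p + Q₀) ^ k * f p := by
        funext p
        have hmx : max (f p) 0 - max (-f p) 0 = f p := max_zero_sub_max_neg_zero_eq_self (f p)
        have hφp : φ p = massSq p + Q₀ := rfl
        calc max (f p) 0 * φ p ^ k - max (-f p) 0 * φ p ^ k = (max (f p) 0 - max (-f p) 0) * φ p ^ k := by ring
          _ = (massSq p + Q₀) ^ k * f p := by rw [hmx, hφp]; ring
      rw [e]
      exact hmom k
    linarith
  -- determinacy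
  have heq : σ = τ := oneSidedDeterminacy_holds σ τ c hcpos inferInstance inferInstance hσ0 hτ0 hσi hτi hmomeq
  -- read off the window `S` (shifted by `Q₀`)
  set S' : Set ℝ := (fun x : ℝ => x - Q₀) ⁻¹' S with hS'
  have hS'm : MeasurableSet S' := (measurable_id.sub_const Q₀) hS
  have hpre : φ ⁻¹' S' = massSq ⁻¹' S := by
    ext p
    simp [hS', hφ]
  have hval : (μ.withDensity ρp) (massSq ⁻¹' S) = (μ.withDensity ρm) (massSq ⁻¹' S) := by
    have h1 : σ S' = τ S' := by rw [heq]
    rwa [hσ, hτ, Measure.map_apply hφm hS'm, Measure.map_apply hφm hS'm, hpre] at h1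
  have hA : MeasurableSet (massSq ⁻¹' S) := measurable_massSq hS
  rw [withDensity_apply _ hA, withDensity_apply _ hA] at hval
  -- convert to Bochner integrals
  have hposint : ∫ p in massSq ⁻¹' S, max (f p) 0 ∂μ = (∫⁻ p in massSq ⁻¹' S, ρp p ∂μ).toReal := by
    rw [integral_eq_lintegral_of_nonneg_ae (f := fun p => max (f p) 0) (Eventually.of_forall fun p => le_max_right (f p) 0)
      (hfc.max continuous_const).aestronglyMeasurable]
    congr 1
    refine lintegral_congr fun p => ?_
    simp only [hρp]
    rw [ENNReal.ofReal_max, ENNReal.ofReal_zero, max_eq_left (zero_le)]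
  have hnegint : ∫ p in massSq ⁻¹' S, max (-f p) 0 ∂μ = (∫⁻ p in massSq ⁻¹' S, ρm p ∂μ).toReal := by
    rw [integral_eq_lintegral_of_nonneg_ae (f := fun p => max (-f p) 0) (Eventually.of_forall fun p => le_max_right (-f p) 0)
      (hfc.neg.max continuous_const).aestronglyMeasurable]
    congr 1
    refine lintegral_congr fun p => ?_
    simp only [hρm]
    rw [ENNReal.ofReal_max, ENNReal.ofReal_zero, max_eq_left (zero_le)]
  have hip : Integrable (fun p => max (f p) 0) (μ.restrict (massSq ⁻¹' S)) :=
    (hfi.abs.mono' (hfc.max continuous_const).aestronglyMeasurable (Eventually.of_forall fun p => by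
      rw [Real.norm_eq_abs]; exact hmaxp p)).restrict
  have him : Integrable (fun p => max (-f p) 0) (μ.restrict (massSq ⁻¹' S)) :=
    (hfi.abs.mono' (hfc.neg.max continuous_const).aestronglyMeasurable (Eventually.of_forall fun p => by
      rw [Real.norm_eq_abs]; exact hmaxm p)).restrict
  calc ∫ p in massSq ⁻¹' S, f p ∂μ = ∫ p in massSq ⁻¹' S, (max (f p) 0 - max (-f p) 0) ∂μ := by
        refine integral_congr_ae (ae_of_all _ fun p => ?_)
        exact (max_zero_sub_max_neg_zero_eq_self (f p)).symm
    _ = (∫ p in massSq ⁻¹' S, max (f p) 0 ∂μ) - ∫ p in massSq ⁻¹' S, max (-f p) 0 ∂μ := integral_sub hip him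
    _ = 0 := by rw [hposint, hnegint, hval, sub_self]

end Summit.QuantumFields.YangMills.Theorems.F4SubCurvatureDoorShellSeparationProof

end
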